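import Summits.HodgeConjecture.HodgeConjecture.Theorems.Ring2AbelianAllAndreLerayIdempotentOnPath
import Summits.HodgeConjecture.HodgeConjecture.Theorems.Ring2AbelianAllAndreFibreClassKernelHolds
import HarnessLib

/-!
# Ring 2 · sub-cell AbelianAll (ALL ABELIAN VARIETIES), André axis, part XXVII-e — (Π2) IS DISPENSABLE: the `ℚ`-structure of `Im e` is read
# on the fibre; the complex-coefficient bracket `CMLerayIdempotentC[]` ⟸ (β′), ⟸ `(Q) ∧ B(𝒳)`, ⟸ `HodgeConjecture`, and the same rows

HONEST FRAMING (page 1, verbatim): **research route, not a corollary; conditional on HC_CM plus one named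
minimal statement.** Cell line: research route conditional on HC_CM; not a corollary; Q11.4-sentence-2
already refuted in dim ≥ 3. Nothing in this file proves a case of the Hodge conjecture for an abelian variety; `HC_CM`
(`RankFourFaces.CMAbelianHodge`) is a HYPOTHESIS of the rows that name it; `HodgeConjecture` occurs only as the hypothesis of on-path
lemmas. Item `Theses.RankFourFaces.CMToAbelian` (stmt-16267) OPEN and not closed here. Seat `pub-hodge-ring2-ab-andre-2`, gen 19; brief (ii).

## What is proved (theorems only; no definition, no named fact, no sorry)

Parts XXVII-a/c asked the algebraic Leray idempotent `e` to (Π2) preserve rational classes — true for the Lagrange idempotent of `θ_N`,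
but NOT delivered by the Lefschetz-type suppliers ((β′_f), part XXVII-b (b); `(Q) ∧ B(𝒳)`), whose correspondences have complex
coefficients. THIS FILE removes (Π2): the `ℚ`-structure that matters is that of `Im j_t^* ⊂ H^{2p}(X_t, ℚ)`, read through the
isomorphism `j_t^* : Im e ≅ Im j_t^*`.
§1 `typeProj_comm_of_isOfHodgeType`, `isOfHodgeType_of_fixed'` — part XXVII-a §3 for an endomorphism that merely preserves Hodge types
(the Hodge-theoretic idempotent of part XXVII-d §2 qualifies).
§2 FIBRE-RATIONAL READINGS, for `e` with (Π1), (π), (κ) ONLY: **`comap_le_sup_iff_forall_fixed_fibreRational_hodge_mem`** — at a fibre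
whose rational `(p,p)`-classes are algebraic, (L)_t(p) ⟺ [every `e`-fixed `(p,p)`-class of `𝒳` whose restriction to `X_t` is RATIONAL is
algebraic] (⟸ with no fibre hypothesis: `comap_le_sup_of_forall_fixed_fibreRational_hodge_mem`); `forall_fixed_fibreRational_hodge_mem_of_two`
(independent of `e`); **`fixed_fibreRational_hodge_mem_of_hodgeConjectureFor`** — the reading is a case of HC for `𝒳` (through the
fact-free Hodge idempotent of part XXVII-d and the rational lift of part XVII-a).
§3 NODE LEVEL (display-only brackets): `CMLerayIdempotentC[]` (∃ `e` with (Π1), (π), (κ) in every degree `2p ≤ 2d` at every CM point —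
complex coefficients allowed) and `CMIdempotentHodgeC[]` (for every such `e`: fixed `(p,p)`-classes with rational restriction are
algebraic); edges **`cmLerayIdempotentC_of_fibreClassLefschetzOnCMPointedPencils`** ((β′) ⟹, K), **`cmLerayIdempotentC_of_quasiInverse_of_lefschetzB`**
(`(Q) ∧ (5)` ⟹, K), `cmLerayIdempotentC_of_cmLerayIdempotent`, `cmLerayIdempotentC_of_hodgeConjecture`, `cmIdempotentHodgeC_of_hodgeConjecture`
(on-path), `cmIdempotentHodgeC_of_cmFibreAlgebraicLift_of_HC_CM`, `cmFibreAlgebraicLift_of_cmIdempotentHodgeC` (mod `CMLerayIdempotentC[]`);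
rows **`HC_AV_of_HC_CM_of_cmIdempotentHodgeC (h₂₁) (hE : CMLerayIdempotentC[]) (hCM) (h)`**, **`HC_AV_iff_HC_CM_and_cmIdempotentHodgeC_of_verdier`**.

## Honest status

No node is born; nothing is minimal; nothing here is fact-free progress on `HC_AV`. The displayed existence hypothesis of the André-axis
exactness row is now at its weakest typed form: ONE algebraic cycle class (complex coefficients) on `𝒳 × 𝒳` per (pencil, CM point,
degree `2p ≤ 2d`) acting on `H^{2p}(𝒳)` with `j_t^* ∘ e = j_t^*` and `e|_{ker j_t^*} = 0`; it is implied (K) by (θ∀), by (β′), by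
`(Q) ∧ (5)` and by `HodgeConjecture`, and the exactness row holds modulo it, [h₂₁] and Verdier.

References: Milne2020HodgeClassesAV (proof of Prop. 1); DeningerMurre1991 (Thm. 3.1); Abdulali1994FamiliesAV (Conj. 5.3); Andre1996Motifs
(§2.1, Prop. 3.3, Lemme 6.3.1, Remarque 2); VoisinHodgeI2002 (§7.1.1, Lemma 11.41); Voisin2025 (Prop. 2.11); Verdier1976 (Cor. 5.1).
-/

noncomputable section

set_option linter.dupNamespace false

namespace Summit.HodgeConjecture.HodgeConjecture.Ring2.AbelianAll

open CategoryTheory AlgebraicGeometry MonoidalCategory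
open Literature.AlgebraicGeometry Literature.AlgebraicGeometry.Motives
open Literature.AlgebraicGeometry.HodgeTheory
open Literature.AlgebraicGeometry.Deligne1982 (cmLocus)
open Literature.AlgebraicGeometry.Andre1996 (andre1996_cmAnchoredPencil)
open Summit.HodgeConjecture.HodgeConjecture
open Summit.HodgeConjecture.HodgeConjecture.Theses
open Summit.HodgeConjecture.HodgeConjecture.Ring2.Deform (HC_CM_of_HC_AV)

/-! ## §1 Type projectors for a type-preserving endomorphism -/

section TypePreserving

variable {n : ℕ} {X : SchemeOver ℂ}

/-- A type-preserving endomorphism commutes with the Hodge-type projectors (uniqueness of the type decomposition, Voisin I Thm. 6.18).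
[cite: VoisinHodgeI2002, Thm. 6.18 and §7.1.1] -/
theorem typeProj_comm_of_isOfHodgeType (hX : IsSmoothProjective n X) (A : HodgeModel n X) {k : ℕ}
    (T : complexBetti X k →ₗ[ℂ] complexBetti X k) (hT : ∀ (p q : ℕ) (c : complexBetti X k), IsOfHodgeType n X k p q c →
      IsOfHodgeType n X k p q (T c)) (pq : ↥(Finset.HasAntidiagonal.antidiagonal k)) (c : complexBetti X k) :
    A.typeProj k pq (T c) = T (A.typeProj k pq c) := by
  refine A.typeProj_eq_of_sum_eq (y := fun pq' ↦ T (A.typeProj k pq' c)) ?_ ?_ pq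
  · intro pq'
    exact A.mem_typePiece_of_isOfHodgeType hodgePQ_independent_of_hodgeModel_holds hX pq'.2
      (hT _ _ _ (A.isOfHodgeType_of_mem_typePiece (A.typeProj_mem k pq' c)))
  · rw [← map_sum, A.sum_typeProj]

end TypePreserving

section FixedType

variable {𝒳 S : SchemeOver ℂ} {d : ℕ} {f : 𝒳 ⟶ S}

/-- Part XXVII-a `isOfHodgeType_of_fixed` for an endomorphism that merely PRESERVES HODGE TYPES (and (κ)): an `e`-fixed class reads its
Hodge type on the fibre. [cite: DeligneHodgeII1971, Cor. 4.1.2] [cite: VoisinHodgeI2002, §7.1.1 and §7.3.2] -/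
theorem isOfHodgeType_of_fixed' (hf : IsCompactAbelianPencil f d) (t : ComplexPoints S) {k : ℕ}
    (e : complexBetti 𝒳 k →ₗ[ℂ] complexBetti 𝒳 k)
    (htyp : ∀ (p q : ℕ) (c : complexBetti 𝒳 k), IsOfHodgeType (d + 1) 𝒳 k p q c → IsOfHodgeType (d + 1) 𝒳 k p q (e c))
    (hκ : ∀ w, complexBetti.map (fiberι f t) k w = 0 → e w = 0) {p q : ℕ} (hpq : p + q = k)
    {y₀ : complexBetti 𝒳 k} (hy₀ : e y₀ = y₀) (hH : IsOfHodgeType d (fiberOver f t) k p q (complexBetti.map (fiberι f t) k y₀)) :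
    IsOfHodgeType (d + 1) 𝒳 k p q y₀ := by
  have h𝒳 := hf.isSmoothProjective_total
  have hXt := hf.isSmoothProjective_fiberOver t
  obtain ⟨A⟩ := nonempty_hodgeModel_holds h𝒳
  have hmem : (p, q) ∈ Finset.HasAntidiagonal.antidiagonal k := Finset.HasAntidiagonal.mem_antidiagonal.2 hpq
  have hcomp := (isOfHodgeType_map_iff_forall_typeProj h𝒳 hXt (fiberι f t) A hpq y₀).1 hH
  have hzero : ∀ pq' : ↥(Finset.HasAntidiagonal.antidiagonal k), pq'.1 ≠ (p, q) → A.typeProj k pq' y₀ = 0 := by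
    intro pq' hne
    refine fixed_eq_zero_of_map_fiberι_eq_zero t e hκ ?_ (hcomp pq' hne)
    rw [← typeProj_comm_of_isOfHodgeType h𝒳 A e htyp pq' y₀, hy₀]
  have hsum : y₀ = A.typeProj k ⟨(p, q), hmem⟩ y₀ := by
    conv_lhs => rw [← A.sum_typeProj k y₀]
    rw [Finset.sum_eq_single ⟨(p, q), hmem⟩]
    · intro pq' _ hne
      exact hzero pq' fun heq ↦ hne (Subtype.ext heq)
    · intro habs
      exact absurd (Finset.mem_univ _) habs
  have h := A.isOfHodgeType_of_mem_typePiece (A.typeProj_mem k ⟨(p, q), hmem⟩ y₀)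
  dsimp only at h
  rwa [← hsum] at h

end FixedType

/-! ## §2 Fibre-rational readings: (Π2) is not needed -/

section FibreRational

variable {𝒳 S : SchemeOver ℂ} {d : ℕ} {f : 𝒳 ⟶ S}

/-- **[every `e`-fixed `(p,p)`-class with RATIONAL RESTRICTION to `X_t` is algebraic] ⟹ (L)_t(p)**, for `e` with (Π1), (π), (κ) only (no
(Π2)): for a rational `W` with algebraic restriction, `e W` is fixed, restricts to the rational algebraic class `j_t^* W`, and is of type
`(p,p)` (part XXVII-a). [cite: Milne2020HodgeClassesAV, proof of Prop. 1 (pp. 7–8)] [cite: VoisinHodgeI2002, §7.1.1 and §11.3] -/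
theorem comap_le_sup_of_forall_fixed_fibreRational_hodge_mem (hf : IsCompactAbelianPencil f d) (t : ComplexPoints S) {p : ℕ}
    (e : complexBetti 𝒳 (2 * p) →ₗ[ℂ] complexBetti 𝒳 (2 * p)) (halg : IsAlgebraicCorrespondence (d + 1) (d + 1) 𝒳 𝒳 e)
    (hπ : ∀ w, complexBetti.map (fiberι f t) (2 * p) (e w) = complexBetti.map (fiberι f t) (2 * p) w)
    (hκ : ∀ w, complexBetti.map (fiberι f t) (2 * p) w = 0 → e w = 0)
    (h : ∀ y₀ : complexBetti 𝒳 (2 * p), e y₀ = y₀ → IsRationalClass (complexBetti.map (fiberι f t) (2 * p) y₀) →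
      IsOfHodgeType (d + 1) 𝒳 (2 * p) p p y₀ → y₀ ∈ algebraicClasses 𝒳 p) :
    (algebraicClasses (fiberOver f t) p).comap (complexBetti.map (fiberι f t) (2 * p)).hom ≤
      algebraicClasses 𝒳 p ⊔ LinearMap.ker (complexBetti.map (fiberι f t) (2 * p)).hom := by
  have hXt := hf.isSmoothProjective_fiberOver t
  intro W hW
  have hW' : complexBetti.map (fiberι f t) (2 * p) W ∈ algebraicClasses (fiberOver f t) p := hW
  refine (Submodule.span_le (p := algebraicClasses 𝒳 p ⊔ LinearMap.ker (complexBetti.map (fiberι f t) (2 * p)).hom)).2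
    ?_ (mem_span_rational_of_map_fiberι_mem_algebraicClasses hf hW')
  rintro W' ⟨hW'Q, hW'alg⟩
  have hfix : e (e W') = e W' := leray_idempotent t e hπ hκ W'
  have hres : complexBetti.map (fiberι f t) (2 * p) (e W') = complexBetti.map (fiberι f t) (2 * p) W' := hπ W'
  have hH : IsOfHodgeType (d + 1) 𝒳 (2 * p) p p (e W') :=
    isOfHodgeType_of_fixed hf t e halg hκ (by omega) hfix
      (by rw [hres]; exact isOfHodgeType_of_mem_algebraicClasses_of_isSmoothProjective hXt p hW'alg)
  have hW₀alg : e W' ∈ algebraicClasses 𝒳 p :=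
    h (e W') hfix (by rw [hres]; exact hW'Q.map (AlgPoints.mapContinuous (L := ℂ) (fiberι f t))) hH
  change W' ∈ algebraicClasses 𝒳 p ⊔ LinearMap.ker (complexBetti.map (fiberι f t) (2 * p)).hom
  rw [show W' = e W' + (W' - e W') by abel]
  refine Submodule.add_mem_sup hW₀alg ?_
  rw [LinearMap.mem_ker]
  change complexBetti.map (fiberι f t) (2 * p) (W' - e W') = 0
  rw [map_sub, hres, sub_self]

/-- **(L)_t(p) ⟹ [every `e`-fixed `(p,p)`-class with rational restriction is algebraic]**, at a fibre whose rational `(p,p)`-classes are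
algebraic (a CM fibre under `HC_CM`), for `e` with (Π1), (π), (κ). [cite: Milne2020HodgeClassesAV, proof of Prop. 1 (pp. 7–8)] -/
theorem fixed_fibreRational_hodge_mem_of_comap_le_sup (hf : IsCompactAbelianPencil f d) (t : ComplexPoints S) {p : ℕ}
    (e : complexBetti 𝒳 (2 * p) →ₗ[ℂ] complexBetti 𝒳 (2 * p)) (halg : IsAlgebraicCorrespondence (d + 1) (d + 1) 𝒳 𝒳 e)
    (hπ : ∀ w, complexBetti.map (fiberι f t) (2 * p) (e w) = complexBetti.map (fiberι f t) (2 * p) w)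
    (hκ : ∀ w, complexBetti.map (fiberι f t) (2 * p) w = 0 → e w = 0)
    (hfib : ∀ c : complexBetti (fiberOver f t) (2 * p), IsRationalClass c →
      IsOfHodgeType d (fiberOver f t) (2 * p) p p c → c ∈ algebraicClasses (fiberOver f t) p)
    (hL : (algebraicClasses (fiberOver f t) p).comap (complexBetti.map (fiberι f t) (2 * p)).hom ≤
      algebraicClasses 𝒳 p ⊔ LinearMap.ker (complexBetti.map (fiberι f t) (2 * p)).hom) :
    ∀ y₀ : complexBetti 𝒳 (2 * p), e y₀ = y₀ → IsRationalClass (complexBetti.map (fiberι f t) (2 * p) y₀) →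
      IsOfHodgeType (d + 1) 𝒳 (2 * p) p p y₀ → y₀ ∈ algebraicClasses 𝒳 p := by
  intro y₀ hy₀ hQ hH
  refine (comap_le_sup_iff_forall_fixed_mem hf t e halg hπ hκ).1 hL y₀ hy₀ (hfib _ hQ ?_)
  exact hH.map_of_isSmoothProjective (hf.isSmoothProjective_fiberOver t) hf.isSmoothProjective_total (fiberι f t)

/-- **(L)_t(p) ⟺ [the `e`-fixed `(p,p)`-classes with rational restriction are algebraic]** (fibre with HC on its rational `(p,p)`-classes;
`e` with (Π1), (π), (κ); NO (Π2)). [cite: Milne2020HodgeClassesAV, proof of Prop. 1 (pp. 7–8)] [cite: DeningerMurre1991, Thm. 3.1] -/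
theorem comap_le_sup_iff_forall_fixed_fibreRational_hodge_mem (hf : IsCompactAbelianPencil f d) (t : ComplexPoints S) {p : ℕ}
    (e : complexBetti 𝒳 (2 * p) →ₗ[ℂ] complexBetti 𝒳 (2 * p)) (halg : IsAlgebraicCorrespondence (d + 1) (d + 1) 𝒳 𝒳 e)
    (hπ : ∀ w, complexBetti.map (fiberι f t) (2 * p) (e w) = complexBetti.map (fiberι f t) (2 * p) w)
    (hκ : ∀ w, complexBetti.map (fiberι f t) (2 * p) w = 0 → e w = 0)
    (hfib : ∀ c : complexBetti (fiberOver f t) (2 * p), IsRationalClass c →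
      IsOfHodgeType d (fiberOver f t) (2 * p) p p c → c ∈ algebraicClasses (fiberOver f t) p) :
    (algebraicClasses (fiberOver f t) p).comap (complexBetti.map (fiberι f t) (2 * p)).hom ≤
        algebraicClasses 𝒳 p ⊔ LinearMap.ker (complexBetti.map (fiberι f t) (2 * p)).hom ↔
      ∀ y₀ : complexBetti 𝒳 (2 * p), e y₀ = y₀ → IsRationalClass (complexBetti.map (fiberι f t) (2 * p) y₀) →
        IsOfHodgeType (d + 1) 𝒳 (2 * p) p p y₀ → y₀ ∈ algebraicClasses 𝒳 p :=
  ⟨fixed_fibreRational_hodge_mem_of_comap_le_sup hf t e halg hπ hκ hfib, comap_le_sup_of_forall_fixed_fibreRational_hodge_mem hf t e halg hπ hκ⟩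

/-- **The fibre-rational reading does not depend on the idempotent**: for `e` with (Π1), (π), (κ) and `e'` with (Π1), (κ) in degree `2p`,
the reading for `e` implies the reading for `e'` (`y = e'(e y) + e'(y − e y)`, `e y` fixed by `e` with the same — rational — restriction and
of type `(p,p)` since `e` respects types). [cite: DeningerMurre1991, Thm. 3.1 and Cor. 3.2] [cite: VoisinHodgeII2003, §9.2.4 Prop. 9.21] -/
theorem forall_fixed_fibreRational_hodge_mem_of_two (hf : IsCompactAbelianPencil f d) (t : ComplexPoints S) {p : ℕ}
    (e e' : complexBetti 𝒳 (2 * p) →ₗ[ℂ] complexBetti 𝒳 (2 * p)) (halg : IsAlgebraicCorrespondence (d + 1) (d + 1) 𝒳 𝒳 e)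
    (hπ : ∀ w, complexBetti.map (fiberι f t) (2 * p) (e w) = complexBetti.map (fiberι f t) (2 * p) w)
    (hκ : ∀ w, complexBetti.map (fiberι f t) (2 * p) w = 0 → e w = 0)
    (halg' : IsAlgebraicCorrespondence (d + 1) (d + 1) 𝒳 𝒳 e')
    (hκ' : ∀ w, complexBetti.map (fiberι f t) (2 * p) w = 0 → e' w = 0)
    (h : ∀ y₀ : complexBetti 𝒳 (2 * p), e y₀ = y₀ → IsRationalClass (complexBetti.map (fiberι f t) (2 * p) y₀) →
      IsOfHodgeType (d + 1) 𝒳 (2 * p) p p y₀ → y₀ ∈ algebraicClasses 𝒳 p) :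
    ∀ y₀ : complexBetti 𝒳 (2 * p), e' y₀ = y₀ → IsRationalClass (complexBetti.map (fiberι f t) (2 * p) y₀) →
      IsOfHodgeType (d + 1) 𝒳 (2 * p) p p y₀ → y₀ ∈ algebraicClasses 𝒳 p := by
  have h𝒳 := hf.isSmoothProjective_total
  intro y hy hyQ hyH
  have he : e y ∈ algebraicClasses 𝒳 p :=
    h (e y) (leray_idempotent t e hπ hκ y) (by rw [hπ]; exact hyQ) (IsAlgebraicCorrespondence.isOfHodgeType_endo h𝒳 halg hyH)
  have hdiff : e' (y - e y) = 0 := hκ' _ (by rw [map_sub, hπ, sub_self])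
  have hy' : y = e' (e y) := by
    conv_lhs => rw [← hy, show y = e y + (y - e y) by abel, map_add, hdiff, add_zero]
  rw [hy']
  exact map_mem_algebraicClasses_of_isAlgebraicCorrespondence h𝒳 h𝒳 halg' he

/-- **ON-PATH: the Hodge conjecture for `𝒳` implies the fibre-rational reading** for every `e` with (Π1), (κ) in degree `2p` ((π) is not used): an
`e`-fixed `(p,p)`-class `y₀` with rational restriction has a RATIONAL global companion `W` with the same fibre restrictions (part XVII-a); the
Hodge-theoretic idempotent `e_H` of part XXVII-d gives the rational `(p,p)`-class `e_H W`, algebraic by HC for `𝒳`; and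
`y₀ = e(e_H W) + e(y₀ − e_H W) = e(e_H W)`. [cite: Deligne2000, §1] [cite: Voisin2025, Prop. 2.11] [cite: VoisinHodgeI2002, §7.1.1] -/
theorem fixed_fibreRational_hodge_mem_of_hodgeConjectureFor (hf : IsCompactAbelianPencil f d)
    (hHC : HodgeConjectureFor (d + 1) 𝒳) (t : ComplexPoints S) {p : ℕ}
    (e : complexBetti 𝒳 (2 * p) →ₗ[ℂ] complexBetti 𝒳 (2 * p)) (halg : IsAlgebraicCorrespondence (d + 1) (d + 1) 𝒳 𝒳 e)
    (hκ : ∀ w, complexBetti.map (fiberι f t) (2 * p) w = 0 → e w = 0) :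
    ∀ y₀ : complexBetti 𝒳 (2 * p), e y₀ = y₀ → IsRationalClass (complexBetti.map (fiberι f t) (2 * p) y₀) →
      IsOfHodgeType (d + 1) 𝒳 (2 * p) p p y₀ → y₀ ∈ algebraicClasses 𝒳 p := by
  have h𝒳 := hf.isSmoothProjective_total
  have hXt := hf.isSmoothProjective_fiberOver t
  intro y₀ hy₀ hQ hH
  obtain ⟨eH, hQH, hπH, hκH, htypH⟩ := exists_hodge_idempotent_of_map h𝒳 hXt (fiberι f t) (2 * p)
  obtain ⟨W, hWQ, hWs⟩ := exists_isRationalClass_map_fiberι_eq hf y₀ hQ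
  have hres : complexBetti.map (fiberι f t) (2 * p) (eH W) = complexBetti.map (fiberι f t) (2 * p) y₀ := by rw [hπH, hWs t]
  have hHW : IsOfHodgeType (d + 1) 𝒳 (2 * p) p p (eH W) :=
    isOfHodgeType_of_fixed' hf t eH htypH hκH (by omega) (leray_idempotent t eH hπH hκH W)
      (by rw [hres]; exact hH.map_of_isSmoothProjective hXt h𝒳 (fiberι f t))
  have halgW : eH W ∈ algebraicClasses 𝒳 p := hHC.2 p (eH W) (hQH W hWQ) hHW
  have hdiff : e (y₀ - eH W) = 0 := hκ _ (by rw [map_sub, hres, sub_self])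
  have hy : y₀ = e (eH W) := by
    conv_lhs => rw [← hy₀, show y₀ = eH W + (y₀ - eH W) by abel, map_add, hdiff, add_zero]
  rw [hy]
  exact map_mem_algebraicClasses_of_isAlgebraicCorrespondence h𝒳 h𝒳 halg halgW

end FibreRational

/-! ## §3 Node level: the complex-coefficient bracket and its suppliers -/

section Nodes

variable {𝒳 S : SchemeOver ℂ} {d : ℕ} {f : 𝒳 ⟶ S}

/-- Per pencil: **`(Q) ∧ B(𝒳)` give an idempotent with (Π1), (π), (κ)** in every degree `2p ≤ 2d`: the algebraic quasi-inverse `v` of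
`u = L_t = j_{t*} j_t^*` (ab-andre-1's node (Q) fed with `B(𝒳)`; `L_t` is algebraic) yields `e = v ∘ L_t`; `L_t e = L_t` gives (π) by the kernel
identity (κ) of part X (a tree theorem, Deligne), and (κ) is immediate. [cite: Andre1996Motifs, Prop. 3.3 (pp. 21–22) and Remarque 2 (p. 33)]
[cite: DeligneHodgeII1971, Thm. 4.1.1] -/
theorem exists_lerayIdempotentC_of_quasiInverse_of_standardConjectureBStar (hf : IsCompactAbelianPencil f d)
    (hQ : AlgebraicQuasiInverseOfLefschetzStandard) (hB : ∀ η : complexBetti 𝒳 2, StandardConjectureBStar (d + 1) 𝒳 η)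
    (t : ComplexPoints S) {p : ℕ} (hp : p ≤ d) :
    ∃ e : complexBetti 𝒳 (2 * p) →ₗ[ℂ] complexBetti 𝒳 (2 * p),
      IsAlgebraicCorrespondence (d + 1) (d + 1) 𝒳 𝒳 e ∧
      (∀ w, complexBetti.map (fiberι f t) (2 * p) (e w) = complexBetti.map (fiberι f t) (2 * p) w) ∧
      (∀ w, complexBetti.map (fiberι f t) (2 * p) w = 0 → e w = 0) := by
  have h𝒳 := hf.isSmoothProjective_total
  obtain ⟨v, hv, hvL⟩ := exists_algebraic_quasiInverse_fiberGysin_of_standardConjectureBStar hf hQ hB hp t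
  refine ⟨v ∘ₗ (fiberGysin hf t p ∘ₗ (complexBetti.map (fiberι f t) (2 * p)).hom), ?_, fun w ↦ ?_, fun w hw ↦ ?_⟩
  · exact IsAlgebraicCorrespondence.comp h𝒳 h𝒳 h𝒳 (isAlgebraicCorrespondence_fiberGysin_comp_map hf t hp) hv (by omega)
  · -- `L_t (e w - w) = 0`, hence `j_t^*(e w - w) = 0`
    have h0 : fiberGysin hf t p (complexBetti.map (fiberι f t) (2 * p)
        (v (fiberGysin hf t p (complexBetti.map (fiberι f t) (2 * p) w)) - w)) = 0 := by
      rw [map_sub, map_sub, hvL w, sub_self]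
    have h := fibreGysinKernelOn_holds hf p t t _ h0
    rw [map_sub, sub_eq_zero] at h
    simpa only [LinearMap.comp_apply] using h
  · have hw' : (complexBetti.map (fiberι f t) (2 * p)).hom w = 0 := hw
    simp only [LinearMap.comp_apply, hw', map_zero]

/-- DISPLAY-ONLY bracket (no `def`; REFEREE-AB F-ab-103): `CMLerayIdempotent[]` of part XXVII-c, restated verbatim ((Π2) included). -/
local notation3 (prettyPrint := false) "CMLerayIdempotent[]" =>
  ∀ ⦃d : ℕ⦄ ⦃𝒳 S : SchemeOver ℂ⦄ (f : 𝒳 ⟶ S), IsCompactAbelianPencil f d → ∀ t ∈ cmLocus f d, ∀ p : ℕ, p ≤ d →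
    ∃ e : complexBetti 𝒳 (2 * p) →ₗ[ℂ] complexBetti 𝒳 (2 * p),
      IsAlgebraicCorrespondence (d + 1) (d + 1) 𝒳 𝒳 e ∧ (∀ w, IsRationalClass w → IsRationalClass (e w)) ∧
      (∀ w, complexBetti.map (fiberι f t) (2 * p) (e w) = complexBetti.map (fiberι f t) (2 * p) w) ∧
      (∀ w, complexBetti.map (fiberι f t) (2 * p) w = 0 → e w = 0)

/-- DISPLAY-ONLY bracket (no `def`; REFEREE-AB F-ab-103): **`CMLerayIdempotentC[]`** — as `CMLerayIdempotent[]` WITHOUT (Π2): at every CM point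
of every compact pencil of abelian `d`-folds, in every degree `2p ≤ 2d`, an endomorphism of `H^{2p}(𝒳(ℂ); ℂ)` induced by an algebraic cycle on
`𝒳 × 𝒳` (complex coefficients allowed) with `j_t^* ∘ e = j_t^*` and `e|_{ker j_t^*} = 0`. OPEN on the carriers; a HYPOTHESIS wherever used. -/
local notation3 (prettyPrint := false) "CMLerayIdempotentC[]" =>
  ∀ ⦃d : ℕ⦄ ⦃𝒳 S : SchemeOver ℂ⦄ (f : 𝒳 ⟶ S), IsCompactAbelianPencil f d → ∀ t ∈ cmLocus f d, ∀ p : ℕ, p ≤ d →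
    ∃ e : complexBetti 𝒳 (2 * p) →ₗ[ℂ] complexBetti 𝒳 (2 * p),
      IsAlgebraicCorrespondence (d + 1) (d + 1) 𝒳 𝒳 e ∧
      (∀ w, complexBetti.map (fiberι f t) (2 * p) (e w) = complexBetti.map (fiberι f t) (2 * p) w) ∧
      (∀ w, complexBetti.map (fiberι f t) (2 * p) w = 0 → e w = 0)

/-- DISPLAY-ONLY bracket (no `def`; REFEREE-AB F-ab-103): **`CMIdempotentHodgeC[]`** — at CM points, for EVERY `e` with (Π1), (π), (κ) in degree
`2p`: every `e`-fixed `(p,p)`-class whose restriction to the CM fibre is RATIONAL is algebraic ("HC for `Im e` in the `ℚ`-structure read on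
the fibre"). OPEN; a HYPOTHESIS wherever used. -/
local notation3 (prettyPrint := false) "CMIdempotentHodgeC[]" =>
  ∀ ⦃d : ℕ⦄ ⦃𝒳 S : SchemeOver ℂ⦄ (f : 𝒳 ⟶ S), IsCompactAbelianPencil f d → ∀ t ∈ cmLocus f d,
    ∀ (p : ℕ) (e : complexBetti 𝒳 (2 * p) →ₗ[ℂ] complexBetti 𝒳 (2 * p)), IsAlgebraicCorrespondence (d + 1) (d + 1) 𝒳 𝒳 e →
      (∀ w, complexBetti.map (fiberι f t) (2 * p) (e w) = complexBetti.map (fiberι f t) (2 * p) w) →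
      (∀ w, complexBetti.map (fiberι f t) (2 * p) w = 0 → e w = 0) →
      ∀ y₀ : complexBetti 𝒳 (2 * p), e y₀ = y₀ → IsRationalClass (complexBetti.map (fiberι f t) (2 * p) y₀) →
        IsOfHodgeType (d + 1) 𝒳 (2 * p) p p y₀ → y₀ ∈ algebraicClasses 𝒳 p

/-- `CMLerayIdempotent[] ⟹ CMLerayIdempotentC[]` (forget (Π2)); hence also `CMWeights[]`, (θ∀) `PencilTheta[]` supply the complex bracket
(part XXVII-c). [folklore] -/
theorem cmLerayIdempotentC_of_cmLerayIdempotent (h : CMLerayIdempotent[]) : CMLerayIdempotentC[] := by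
  intro d 𝒳 S f hf t ht p hp
  obtain ⟨e, h₁, -, h₃, h₄⟩ := h f hf t ht p hp
  exact ⟨e, h₁, h₃, h₄⟩

/-- **(β′) ⟹ `CMLerayIdempotentC[]` (K)**: the Lefschetz-type node of part VIII supplies the idempotent `e = T ∘ L_t` (part XXVII-b).
[cite: Abdulali1994FamiliesAV, Conjecture 5.3 (p. 1130)] [cite: Andre1996Motifs, Remarque 2 (p. 33)] -/
theorem cmLerayIdempotentC_of_fibreClassLefschetzOnCMPointedPencils (h : FibreClassLefschetzOnCMPointedPencils) : CMLerayIdempotentC[] := by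
  intro d 𝒳 S f hf t ht p hp
  obtain ⟨e, h₁, h₂, h₃⟩ := exists_lerayIdempotent_of_fibreClassLefschetzOn hf (h hf ⟨t, ht⟩) t hp
  exact ⟨e, h₁, fun w ↦ h₂ w t, h₃⟩

/-- **`(Q) ∧ (5)` ⟹ `CMLerayIdempotentC[]` (K)**: ab-andre-1's supply node (Q) and `B(𝒳)` for the CM-pointed compact pencils (node (5)
`LefschetzBCMPointedPencils`) give the idempotent `v ∘ L_t`. [cite: Andre1996Motifs, Prop. 3.3 (pp. 21–22) and Remarque 2 (p. 33)] -/
theorem cmLerayIdempotentC_of_quasiInverse_of_lefschetzB (hQ : AlgebraicQuasiInverseOfLefschetzStandard) (h₅ : LefschetzBCMPointedPencils) :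
    CMLerayIdempotentC[] :=
  fun _ _ _ f hf t ht _ hp ↦ exists_lerayIdempotentC_of_quasiInverse_of_standardConjectureBStar hf hQ (h₅ f hf ⟨t, ht⟩) t hp

/-- **ON-PATH: `HodgeConjecture ⟹ CMLerayIdempotentC[]`** (part XXVII-d). [cite: VoisinHodgeI2002, §11.3.3 Lemma 11.41] [cite: Deligne2000, §1] -/
theorem cmLerayIdempotentC_of_hodgeConjecture (hHC : _root_.HodgeConjecture) : CMLerayIdempotentC[] :=
  cmLerayIdempotentC_of_cmLerayIdempotent (cmLerayIdempotent_of_hodgeConjecture hHC)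

/-- **ON-PATH: `HodgeConjecture ⟹ CMIdempotentHodgeC[]`** (§2, HC for the total space). [cite: Deligne2000, §1] -/
theorem cmIdempotentHodgeC_of_hodgeConjecture (hHC : _root_.HodgeConjecture) : CMIdempotentHodgeC[] :=
  fun _ _ _ _ hf t _ _ e halg _ hκ ↦
    fixed_fibreRational_hodge_mem_of_hodgeConjectureFor hf (hHC hf.isSmoothProjective_total) t e halg hκ

/-- **`HC_CM ∧ (L) ⟹ CMIdempotentHodgeC[]`** (§2 ⟹ at a CM fibre; `HC_CM` a HYPOTHESIS, load-bearing). [cite: Milne2020HodgeClassesAV, proof of Prop. 1 (pp. 7–8)]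
[cite: Andre1996Motifs, §5.1 (p. 25) and §6.3 (p. 33)] -/
theorem cmIdempotentHodgeC_of_cmFibreAlgebraicLift_of_HC_CM (hCM : RankFourFaces.CMAbelianHodge) (hL : CMFibreAlgebraicLift) :
    CMIdempotentHodgeC[] := by
  intro d 𝒳 S f hf t ht p e halg hπ hκ
  obtain ⟨A₀, ⟨e₀⟩, hdim, hcm⟩ := ht
  exact fixed_fibreRational_hodge_mem_of_comap_le_sup hf t e halg hπ hκ
    (fun c hc hcpp ↦ Ring2Transport.mem_algebraicClasses_of_cmChart hCM A₀ e₀ hdim hcm hc hcpp)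
    (cmFibreAlgebraicLift_iff_comap_le_sup.1 hL f hf p t ⟨A₀, ⟨e₀⟩, hdim, hcm⟩)

/-- **`CMIdempotentHodgeC[]` ⟹ (L), granted `CMLerayIdempotentC[]`** (§2 ⟸ at the supplied idempotent; degrees `p > d` vacuous).
[cite: Milne2020HodgeClassesAV, proof of Prop. 1 (pp. 7–8)] [cite: Andre1996Motifs, §5.1 (p. 25)] -/
theorem cmFibreAlgebraicLift_of_cmIdempotentHodgeC (hE : CMLerayIdempotentC[]) (h : CMIdempotentHodgeC[]) : CMFibreAlgebraicLift := by
  refine cmFibreAlgebraicLift_iff_comap_le_sup.2 fun d 𝒳 S f hf p t ht ↦ ?_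
  rcases le_or_gt p d with hp | hp
  · obtain ⟨e, halg, hπ, hκ⟩ := hE f hf t ht p hp
    exact comap_le_sup_of_forall_fixed_fibreRational_hodge_mem hf t e halg hπ hκ (h f hf t ht p e halg hπ hκ)
  · haveI := subsingleton_complexBetti (hf.isSmoothProjective_fiberOver t) (show 2 * d < 2 * p by omega)
    intro W _
    refine Submodule.mem_sup_right ?_
    rw [LinearMap.mem_ker]
    exact Subsingleton.elim _ _

/-- ON-PATH: `HC_AV ⟹ CMIdempotentHodgeC[]` (granted Verdier for part XX's spreading). [cite: Verdier1976, Cor. 5.1] [cite: Andre1996Motifs, §6.3 (p. 33)] -/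
theorem cmIdempotentHodgeC_of_HC_AV_of_verdier (hGT : Verdier1976_genericLocalTriviality) (h : PadicSemiregularLift.HodgeAbelianVarieties) :
    CMIdempotentHodgeC[] :=
  cmIdempotentHodgeC_of_cmFibreAlgebraicLift_of_HC_CM (HC_CM_of_HC_AV h) (cmFibreAlgebraicLift_of_HC_AV_of_verdier hGT h)

/-- **`HC_CM ∧ CMIdempotentHodgeC[] ⟹ HC_AV`, granted [h₂₁] and `CMLerayIdempotentC[]`** (binders in this order; `HC_CM` load-bearing). The André-axis
deliverable with the WEAKEST TYPED existence hypothesis: one algebraic cycle (complex coefficients) per (pencil, CM point, degree) acting as a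
Leray idempotent — supplied (K) by (θ∀), by (β′), by `(Q) ∧ (5)`, and by `HodgeConjecture`. research route, not a corollary; conditional on HC_CM
plus one named minimal statement. [cite: Andre1996Motifs, Lemme 6.3.1 (p. 31) and Remarque 2 (p. 33)] [cite: Milne2020HodgeClassesAV, proof of Prop. 1 (pp. 7–8)] -/
theorem HC_AV_of_HC_CM_of_cmIdempotentHodgeC (h₂₁ : andre1996_cmAnchoredPencil) (hE : CMLerayIdempotentC[])
    (hCM : RankFourFaces.CMAbelianHodge) (h : CMIdempotentHodgeC[]) : PadicSemiregularLift.HodgeAbelianVarieties :=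
  HC_AV_of_HC_CM_and_cmFibreAlgebraicLift h₂₁ hCM (cmFibreAlgebraicLift_of_cmIdempotentHodgeC hE h)

/-- **EXACTNESS: `HC_AV ⟺ HC_CM ∧ CMIdempotentHodgeC[]`, granted [h₂₁], Verdier and `CMLerayIdempotentC[]`.**
[cite: Andre1996Motifs, Lemme 6.3.1 (p. 31) and Remarque 2 (p. 33)] [cite: Verdier1976, Cor. 5.1] -/
theorem HC_AV_iff_HC_CM_and_cmIdempotentHodgeC_of_verdier (h₂₁ : andre1996_cmAnchoredPencil)
    (hGT : Verdier1976_genericLocalTriviality) (hE : CMLerayIdempotentC[]) :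
    PadicSemiregularLift.HodgeAbelianVarieties ↔ (RankFourFaces.CMAbelianHodge ∧ CMIdempotentHodgeC[]) :=
  ⟨fun h ↦ ⟨HC_CM_of_HC_AV h, cmIdempotentHodgeC_of_HC_AV_of_verdier hGT h⟩, fun h ↦ HC_AV_of_HC_CM_of_cmIdempotentHodgeC h₂₁ hE h.1 h.2⟩

end Nodes

end Summit.HodgeConjecture.HodgeConjecture.Ring2.AbelianAll

end
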